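import Literature.NumberTheory.EllipticCurves.TwoDescentTwoTorsionCharacter
import HarnessLib

/-!
# The halving point of a rational point as a geometric point, its Galois conjugates, and `χ₁(σQ - Q)`

Sequel of `TwoDescentTwoTorsionCharacter.lean` (the character `χ₁ : E[2] → μ₂` of `T₁`) and
`TwoDescentHalvingGalois.lean` (the explicit halving formulas). For `P = (x₀, y₀) ∈ E(K)` and square
roots `uᵢ ∈ K̄` of `x₀ - eᵢ` with `u₁u₂u₃ = y₀ + (a₁x₀ + a₃)/2`:

* `geomHalving h hu₁ hu₂ hu₃ ∈ E(K̄)` is the halving point `Q(u₁, u₂, u₃)`, `2 • Q = P`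
  (`two_zsmul_geomHalving`);
* a `K`-automorphism `σ` of `K̄` sends each `uᵢ` to `±uᵢ`, negating an even number of them
  (`halving_sign_cases`; a vanishing `uᵢ` — `P = Tᵢ` — has both signs), and
  `σ • Q(u₁, u₂, u₃) = Q(σu₁, σu₂, σu₃)` (`smul_geomHalving`), while `Q + Tᵢ` is `Q` with two signs
  flipped (`geomHalving_add_geomTwoTorsion₁/₂/₃`); hence `σQ - Q ∈ {O, T₁, T₂, T₃}` is the point
  recording which roots `σ` negates, and
* **`χ₁(σQ - Q) = σ(u₁)/u₁ = σ(u₂u₃)/(u₂u₃)`** (`exists_sign_muVal_twoTorsionChar_smul_geomHalving_sub`)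
  — Silverman AEC, proof of Thm. X.1.1: the Kummer cocycle of `P`, read through `e₂(·, T₁)`, is the
  Kummer cocycle of `x₀ - e₁` (resp. of `(e₁ - e₂)(e₁ - e₃)` at `T₁`). The identification of the
  cohomology classes is `TwoDescentKummerBridge.lean`.

Definitions with bodies and theorems only; no named fact. Cell `bsd-monsky`.

## References

* [SilvermanAEC2009] J. H. Silverman, *The Arithmetic of Elliptic Curves*, 2nd ed., GTM 106,
  Springer 2009, Thm. X.1.1, Prop. X.1.4.
* [Knapp1993] A. W. Knapp, *Elliptic Curves*, Princeton 1993, Thm. 4.2.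
-/

noncomputable section

open scoped Classical

universe u



namespace WeierstrassCurve

open Literature.NumberTheory.GaloisRepresentations Literature.NumberTheory.EllipticCurves Field
open WeierstrassCurve.Affine

variable {K : Type u} [Field K] [CharZero K] (W : WeierstrassCurve K) [W.IsElliptic] {e₁ e₂ e₃ : K}


/-! ### Galois conjugates of the halving point: the signs `σ(uᵢ)/uᵢ` -/

omit [CharZero K] [W.IsElliptic] in
/-- A `K`-automorphism of `K̄` sends a square root of an element of `K` to `±` itself.
[cite: SilvermanAEC2009, Thm. X.1.1] -/
theorem apply_eq_or_eq_neg_of_sq_eq_algebraMap (τ : AlgebraicClosure K ≃ₐ[K] AlgebraicClosure K)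
    {u : AlgebraicClosure K} {c : K} (hu : algebraMap K (AlgebraicClosure K) c = u ^ 2) :
    τ u = u ∨ τ u = -u := by
  rw [← sq_eq_sq_iff_eq_or_eq_neg, ← map_pow, ← hu, AlgEquiv.commutes]

omit [W.IsElliptic] in
/-- **The sign pattern of a Galois conjugate of the halving data.** If `uᵢ² = ι(x₀ - eᵢ)` and
`u₁u₂u₃ = ι(ỹ₀)` with `x₀, eᵢ, ỹ₀ ∈ K`, a `K`-automorphism `τ` of `K̄` negates an even number of
the `uᵢ` (`0` or `2`; when some `uᵢ = 0` its sign is immaterial and is chosen to make the count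
even): one of `(u₁, u₂, u₃)`, `(u₁, -u₂, -u₃)`, `(-u₁, u₂, -u₃)`, `(-u₁, -u₂, u₃)` is `(τu₁, τu₂, τu₃)`.
[cite: SilvermanAEC2009, Thm. X.1.1] -/
theorem halving_sign_cases (τ : AlgebraicClosure K ≃ₐ[K] AlgebraicClosure K) {x₀ : K}
    {u₁ u₂ u₃ : AlgebraicClosure K} {c : K}
    (hu₁ : algebraMap K (AlgebraicClosure K) x₀ - algebraMap K (AlgebraicClosure K) e₁ = u₁ ^ 2)
    (hu₂ : algebraMap K (AlgebraicClosure K) x₀ - algebraMap K (AlgebraicClosure K) e₂ = u₂ ^ 2)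
    (hu₃ : algebraMap K (AlgebraicClosure K) x₀ - algebraMap K (AlgebraicClosure K) e₃ = u₃ ^ 2)
    (hy : algebraMap K (AlgebraicClosure K) c = u₁ * u₂ * u₃) :
    (τ u₁ = u₁ ∧ τ u₂ = u₂ ∧ τ u₃ = u₃) ∨ (τ u₁ = u₁ ∧ τ u₂ = -u₂ ∧ τ u₃ = -u₃) ∨
      (τ u₁ = -u₁ ∧ τ u₂ = u₂ ∧ τ u₃ = -u₃) ∨ (τ u₁ = -u₁ ∧ τ u₂ = -u₂ ∧ τ u₃ = u₃) := by
  have hfix : τ (u₁ * u₂ * u₃) = u₁ * u₂ * u₃ := by rw [← hy, AlgEquiv.commutes]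
  have h1 := apply_eq_or_eq_neg_of_sq_eq_algebraMap τ (c := x₀ - e₁) (by rw [map_sub]; exact hu₁)
  have h2 := apply_eq_or_eq_neg_of_sq_eq_algebraMap τ (c := x₀ - e₂) (by rw [map_sub]; exact hu₂)
  have h3 := apply_eq_or_eq_neg_of_sq_eq_algebraMap τ (c := x₀ - e₃) (by rw [map_sub]; exact hu₃)
  -- in the four "odd" cases the product `u₁u₂u₃` vanishes, and a vanishing `uᵢ` has both signs
  have key : ∀ v : AlgebraicClosure K, -v = v → v = 0 := by
    intro v hv
    have h2v : (2 : AlgebraicClosure K) * v = 0 := by linear_combination -hv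
    exact (mul_eq_zero.mp h2v).resolve_left two_ne_zero
  have hzero : ∀ {v : AlgebraicClosure K}, v = 0 → τ v = v ∧ τ v = -v := by
    intro v hv
    subst hv; simp
  rcases h1 with h1 | h1 <;> rcases h2 with h2 | h2 <;> rcases h3 with h3 | h3
  · exact Or.inl ⟨h1, h2, h3⟩
  · -- `(+, +, -)`: `u₁u₂u₃ = 0`
    have h0 : u₁ * u₂ * u₃ = 0 := by
      rw [map_mul, map_mul, h1, h2, h3] at hfix
      exact key _ (by linear_combination hfix)
    rcases mul_eq_zero.mp h0 with h0 | h0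
    · rcases mul_eq_zero.mp h0 with h0 | h0
      · exact Or.inr (Or.inr (Or.inl ⟨(hzero h0).2, h2, h3⟩))
      · exact Or.inr (Or.inl ⟨h1, (hzero h0).2, h3⟩)
    · exact Or.inl ⟨h1, h2, (hzero h0).1⟩
  · -- `(+, -, +)`
    have h0 : u₁ * u₂ * u₃ = 0 := by
      rw [map_mul, map_mul, h1, h2, h3] at hfix
      exact key _ (by linear_combination hfix)
    rcases mul_eq_zero.mp h0 with h0 | h0
    · rcases mul_eq_zero.mp h0 with h0 | h0
      · exact Or.inr (Or.inr (Or.inr ⟨(hzero h0).2, h2, h3⟩))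
      · exact Or.inl ⟨h1, (hzero h0).1, h3⟩
    · exact Or.inr (Or.inl ⟨h1, h2, (hzero h0).2⟩)
  · exact Or.inr (Or.inl ⟨h1, h2, h3⟩)
  · -- `(-, +, +)`
    have h0 : u₁ * u₂ * u₃ = 0 := by
      rw [map_mul, map_mul, h1, h2, h3] at hfix
      exact key _ (by linear_combination hfix)
    rcases mul_eq_zero.mp h0 with h0 | h0
    · rcases mul_eq_zero.mp h0 with h0 | h0
      · exact Or.inl ⟨(hzero h0).1, h2, h3⟩
      · exact Or.inr (Or.inr (Or.inr ⟨h1, (hzero h0).2, h3⟩))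
    · exact Or.inr (Or.inr (Or.inl ⟨h1, h2, (hzero h0).2⟩))
  · exact Or.inr (Or.inr (Or.inl ⟨h1, h2, h3⟩))
  · exact Or.inr (Or.inr (Or.inr ⟨h1, h2, h3⟩))
  · -- `(-, -, -)`
    have h0 : u₁ * u₂ * u₃ = 0 := by
      rw [map_mul, map_mul, h1, h2, h3] at hfix
      exact key _ (by linear_combination hfix)
    rcases mul_eq_zero.mp h0 with h0 | h0
    · rcases mul_eq_zero.mp h0 with h0 | h0
      · exact Or.inr (Or.inl ⟨(hzero h0).1, h2, h3⟩)
      · exact Or.inr (Or.inr (Or.inl ⟨h1, (hzero h0).1, h3⟩))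
    · exact Or.inr (Or.inr (Or.inr ⟨h1, h2, (hzero h0).1⟩))


/-! ### The halving point as a geometric point, and its Galois conjugates -/

/-- The explicit halving point `Q = (ι x₀ + u₁u₂ + u₁u₃ + u₂u₃, …)` of `P = (x₀, y₀) ∈ E(K)` is a
nonsingular point of `E/K̄` (`uᵢ² = ι(x₀ - eᵢ)`). [cite: Knapp1993, Thm. 4.2] -/
theorem nonsingular_geomHalving (h : W.toAffine.SplitTwoTorsion e₁ e₂ e₃) {x₀ : K}
    {u₁ u₂ u₃ : AlgebraicClosure K}
    (hu₁ : algebraMap K (AlgebraicClosure K) x₀ - algebraMap K (AlgebraicClosure K) e₁ = u₁ ^ 2)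
    (hu₂ : algebraMap K (AlgebraicClosure K) x₀ - algebraMap K (AlgebraicClosure K) e₂ = u₂ ^ 2)
    (hu₃ : algebraMap K (AlgebraicClosure K) x₀ - algebraMap K (AlgebraicClosure K) e₃ = u₃ ^ 2) :
    (W.baseChange (AlgebraicClosure K)).toAffine.Nonsingular
      (algebraMap K (AlgebraicClosure K) x₀ + u₁ * u₂ + u₁ * u₃ + u₂ * u₃)
      ((u₁ + u₂) * (u₁ + u₃) * (u₂ + u₃) -
        ((W.baseChange (AlgebraicClosure K)).a₁ *
          (algebraMap K (AlgebraicClosure K) x₀ + u₁ * u₂ + u₁ * u₃ + u₂ * u₃) +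
          (W.baseChange (AlgebraicClosure K)).a₃) / 2) := by
  haveI := W.isElliptic_baseChange (AlgebraicClosure K)
  exact Affine.Point.nonsingular_halving (h.map (AlgebraicClosure K)) hu₁ hu₂ hu₃

/-- **The explicit halving point** `Q(u₁, u₂, u₃) ∈ E(K̄)` of `P = (x₀, y₀) ∈ E(K)`, for square
roots `uᵢ` of `x₀ - eᵢ` in `K̄` (the point of `TwoDescentHalvingGalois.lean`, as a geometric point).
[cite: Knapp1993, Thm. 4.2] -/
def geomHalving (h : W.toAffine.SplitTwoTorsion e₁ e₂ e₃) {x₀ : K} {u₁ u₂ u₃ : AlgebraicClosure K}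
    (hu₁ : algebraMap K (AlgebraicClosure K) x₀ - algebraMap K (AlgebraicClosure K) e₁ = u₁ ^ 2)
    (hu₂ : algebraMap K (AlgebraicClosure K) x₀ - algebraMap K (AlgebraicClosure K) e₂ = u₂ ^ 2)
    (hu₃ : algebraMap K (AlgebraicClosure K) x₀ - algebraMap K (AlgebraicClosure K) e₃ = u₃ ^ 2) :
    geomPoints W :=
  Affine.Point.some _ _ (W.nonsingular_geomHalving h hu₁ hu₂ hu₃)

/-- **`2 • Q(u) = P`** in `E(K̄)` when the signs are normalised by `u₁u₂u₃ = ι(y₀ + (a₁x₀ + a₃)/2)`.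
[cite: Knapp1993, Thm. 4.2] -/
theorem two_zsmul_geomHalving (h : W.toAffine.SplitTwoTorsion e₁ e₂ e₃) {x₀ y₀ : K}
    (h₀ : W.toAffine.Nonsingular x₀ y₀) {u₁ u₂ u₃ : AlgebraicClosure K}
    (hu₁ : algebraMap K (AlgebraicClosure K) x₀ - algebraMap K (AlgebraicClosure K) e₁ = u₁ ^ 2)
    (hu₂ : algebraMap K (AlgebraicClosure K) x₀ - algebraMap K (AlgebraicClosure K) e₂ = u₂ ^ 2)
    (hu₃ : algebraMap K (AlgebraicClosure K) x₀ - algebraMap K (AlgebraicClosure K) e₃ = u₃ ^ 2)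
    (hy₀ : algebraMap K (AlgebraicClosure K) (y₀ + (W.a₁ * x₀ + W.a₃) / 2) = u₁ * u₂ * u₃) :
    (2 : ℤ) • W.geomHalving h hu₁ hu₂ hu₃ = toGeomPoints W (Affine.Point.some x₀ y₀ h₀) := by
  haveI := W.isElliptic_baseChange (AlgebraicClosure K)
  rw [two_zsmul]
  have h₀' : (W.baseChange (AlgebraicClosure K)).toAffine.Nonsingular
      (algebraMap K (AlgebraicClosure K) x₀) (algebraMap K (AlgebraicClosure K) y₀) :=
    (Affine.map_nonsingular (W := W.toAffine) (algebraMap K (AlgebraicClosure K)).injective x₀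
      y₀).mpr h₀
  have hy₀' : algebraMap K (AlgebraicClosure K) y₀ +
      ((W.baseChange (AlgebraicClosure K)).a₁ * algebraMap K (AlgebraicClosure K) x₀ +
        (W.baseChange (AlgebraicClosure K)).a₃) / 2 = u₁ * u₂ * u₃ := by
    rw [← hy₀]
    simp only [map_add, map_div₀, map_mul, map_ofNat, baseChange, map_a₁, map_a₃]
  exact Affine.Point.halving_add_self (h.map (AlgebraicClosure K)) h₀' hu₁ hu₂ hu₃ hy₀'

/-- **A Galois conjugate of the halving point is the halving point of the conjugate data**:
`σ • Q(u₁, u₂, u₃) = Q(σu₁, σu₂, σu₃)`. [cite: SilvermanAEC2009, Thm. X.1.1] -/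
theorem smul_geomHalving (h : W.toAffine.SplitTwoTorsion e₁ e₂ e₃) (σ : absoluteGaloisGroup K)
    {x₀ : K} {u₁ u₂ u₃ v₁ v₂ v₃ : AlgebraicClosure K}
    (hu₁ : algebraMap K (AlgebraicClosure K) x₀ - algebraMap K (AlgebraicClosure K) e₁ = u₁ ^ 2)
    (hu₂ : algebraMap K (AlgebraicClosure K) x₀ - algebraMap K (AlgebraicClosure K) e₂ = u₂ ^ 2)
    (hu₃ : algebraMap K (AlgebraicClosure K) x₀ - algebraMap K (AlgebraicClosure K) e₃ = u₃ ^ 2)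
    (hv₁ : algebraMap K (AlgebraicClosure K) x₀ - algebraMap K (AlgebraicClosure K) e₁ = v₁ ^ 2)
    (hv₂ : algebraMap K (AlgebraicClosure K) x₀ - algebraMap K (AlgebraicClosure K) e₂ = v₂ ^ 2)
    (hv₃ : algebraMap K (AlgebraicClosure K) x₀ - algebraMap K (AlgebraicClosure K) e₃ = v₃ ^ 2)
    (h₁ : σ • u₁ = v₁) (h₂ : σ • u₂ = v₂) (h₃ : σ • u₃ = v₃) :
    σ • W.geomHalving h hu₁ hu₂ hu₃ = W.geomHalving h hv₁ hv₂ hv₃ := by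
  set τ : AlgebraicClosure K ≃ₐ[K] AlgebraicClosure K := σ
  have hτ₁ : τ u₁ = v₁ := h₁
  have hτ₂ : τ u₂ = v₂ := h₂
  have hτ₃ : τ u₃ = v₃ := h₃
  show Affine.Point.map (W' := W) (τ : AlgebraicClosure K →ₐ[K] AlgebraicClosure K)
    (W.geomHalving h hu₁ hu₂ hu₃) = _
  unfold geomHalving
  rw [Affine.Point.map_some]
  simp only [Affine.Point.some.injEq, AlgEquiv.coe_toAlgHom]
  constructor
  · simp only [map_add, map_mul, τ.commutes, hτ₁, hτ₂, hτ₃]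
  · simp only [map_sub, map_div₀, map_add, map_mul, map_ofNat, τ.commutes, hτ₁, hτ₂, hτ₃,
      baseChange, map_a₁, map_a₃]

/-- **`Q(u) + T₁ = Q(u₁, -u₂, -u₃)`** in `E(K̄)`. [cite: SilvermanAEC2009, Thm. X.1.1] -/
theorem geomHalving_add_geomTwoTorsion₁ (h : W.toAffine.SplitTwoTorsion e₁ e₂ e₃) {x₀ : K}
    {u₁ u₂ u₃ : AlgebraicClosure K}
    (hu₁ : algebraMap K (AlgebraicClosure K) x₀ - algebraMap K (AlgebraicClosure K) e₁ = u₁ ^ 2)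
    (hu₂ : algebraMap K (AlgebraicClosure K) x₀ - algebraMap K (AlgebraicClosure K) e₂ = u₂ ^ 2)
    (hu₃ : algebraMap K (AlgebraicClosure K) x₀ - algebraMap K (AlgebraicClosure K) e₃ = u₃ ^ 2) :
    W.geomHalving h hu₁ hu₂ hu₃ + W.geomTwoTorsion h =
      W.geomHalving h hu₁ (by rw [hu₂]; ring : algebraMap K (AlgebraicClosure K) x₀ - algebraMap K (AlgebraicClosure K) e₂ = (-u₂) ^ 2)
        (by rw [hu₃]; ring : algebraMap K (AlgebraicClosure K) x₀ - algebraMap K (AlgebraicClosure K) e₃ = (-u₃) ^ 2) := by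
  haveI := W.isElliptic_baseChange (AlgebraicClosure K)
  exact Affine.Point.halving_add_twoTorsion₁ (h.map (AlgebraicClosure K)) hu₁ hu₂ hu₃

/-- **`Q(u) + T₂ = Q(-u₁, u₂, -u₃)`** in `E(K̄)`. [cite: SilvermanAEC2009, Thm. X.1.1] -/
theorem geomHalving_add_geomTwoTorsion₂ (h : W.toAffine.SplitTwoTorsion e₁ e₂ e₃) {x₀ : K}
    {u₁ u₂ u₃ : AlgebraicClosure K}
    (hu₁ : algebraMap K (AlgebraicClosure K) x₀ - algebraMap K (AlgebraicClosure K) e₁ = u₁ ^ 2)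
    (hu₂ : algebraMap K (AlgebraicClosure K) x₀ - algebraMap K (AlgebraicClosure K) e₂ = u₂ ^ 2)
    (hu₃ : algebraMap K (AlgebraicClosure K) x₀ - algebraMap K (AlgebraicClosure K) e₃ = u₃ ^ 2) :
    W.geomHalving h hu₁ hu₂ hu₃ + W.geomTwoTorsion h.swap₁₂ =
      W.geomHalving h (by rw [hu₁]; ring : algebraMap K (AlgebraicClosure K) x₀ - algebraMap K (AlgebraicClosure K) e₁ = (-u₁) ^ 2) hu₂
        (by rw [hu₃]; ring : algebraMap K (AlgebraicClosure K) x₀ - algebraMap K (AlgebraicClosure K) e₃ = (-u₃) ^ 2) := by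
  haveI := W.isElliptic_baseChange (AlgebraicClosure K)
  exact Affine.Point.halving_add_twoTorsion₂ (h.map (AlgebraicClosure K)) hu₁ hu₂ hu₃

/-- **`Q(u) + T₃ = Q(-u₁, -u₂, u₃)`** in `E(K̄)`. [cite: SilvermanAEC2009, Thm. X.1.1] -/
theorem geomHalving_add_geomTwoTorsion₃ (h : W.toAffine.SplitTwoTorsion e₁ e₂ e₃) {x₀ : K}
    {u₁ u₂ u₃ : AlgebraicClosure K}
    (hu₁ : algebraMap K (AlgebraicClosure K) x₀ - algebraMap K (AlgebraicClosure K) e₁ = u₁ ^ 2)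
    (hu₂ : algebraMap K (AlgebraicClosure K) x₀ - algebraMap K (AlgebraicClosure K) e₂ = u₂ ^ 2)
    (hu₃ : algebraMap K (AlgebraicClosure K) x₀ - algebraMap K (AlgebraicClosure K) e₃ = u₃ ^ 2) :
    W.geomHalving h hu₁ hu₂ hu₃ + W.geomTwoTorsion h.swap₂₃.swap₁₂ =
      W.geomHalving h (by rw [hu₁]; ring : algebraMap K (AlgebraicClosure K) x₀ - algebraMap K (AlgebraicClosure K) e₁ = (-u₁) ^ 2)
        (by rw [hu₂]; ring : algebraMap K (AlgebraicClosure K) x₀ - algebraMap K (AlgebraicClosure K) e₂ = (-u₂) ^ 2) hu₃ := by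
  haveI := W.isElliptic_baseChange (AlgebraicClosure K)
  exact Affine.Point.halving_add_twoTorsion₃ (h.map (AlgebraicClosure K)) hu₁ hu₂ hu₃


/-! ### The value of `χ₁` on the Kummer cocycle of the halving point -/

/-- **The Kummer cocycle of `P`, read through `χ₁`, is the sign `σ(u₁)/u₁`.** For the halving point
`Q = Q(u₁, u₂, u₃)` of `P = (x₀, y₀) ∈ E(K)` and `σ ∈ Γ_K`: `χ₁(σQ - Q) = s` where `s = ±1` is the
common sign with `σu₁ = s·u₁` and `σ(u₂u₃) = s·u₂u₃` (Silverman AEC X.1, proof of Thm. X.1.1: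
`σQ - Q ∈ {O, T₁}` iff `σ` fixes `√(x₀ - e₁)`). [cite: SilvermanAEC2009, Thm. X.1.1] -/
theorem exists_sign_muVal_twoTorsionChar_smul_geomHalving_sub (h : W.toAffine.SplitTwoTorsion e₁ e₂ e₃)
    (σ : absoluteGaloisGroup K) {x₀ c : K} {u₁ u₂ u₃ : AlgebraicClosure K}
    (hu₁ : algebraMap K (AlgebraicClosure K) x₀ - algebraMap K (AlgebraicClosure K) e₁ = u₁ ^ 2)
    (hu₂ : algebraMap K (AlgebraicClosure K) x₀ - algebraMap K (AlgebraicClosure K) e₂ = u₂ ^ 2)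
    (hu₃ : algebraMap K (AlgebraicClosure K) x₀ - algebraMap K (AlgebraicClosure K) e₃ = u₃ ^ 2)
    (hy : algebraMap K (AlgebraicClosure K) c = u₁ * u₂ * u₃)
    (hmem : σ • W.geomHalving h hu₁ hu₂ hu₃ - W.geomHalving h hu₁ hu₂ hu₃ ∈ geomTorsion W 2) :
    ∃ s : AlgebraicClosure K, (s = 1 ∨ s = -1) ∧
      ((muVal K 2 (W.twoTorsionChar h ⟨_, hmem⟩) : (AlgebraicClosure K)ˣ) : AlgebraicClosure K) = s ∧
      σ • u₁ = s * u₁ ∧ σ • (u₂ * u₃) = s * (u₂ * u₃) := by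
  set τ : AlgebraicClosure K ≃ₐ[K] AlgebraicClosure K := σ
  have hs := halving_sign_cases (e₁ := e₁) (e₂ := e₂) (e₃ := e₃) τ hu₁ hu₂ hu₃ hy
  rw [twoTorsionChar_apply, muVal_twoTorsionCharFun]
  have h10 := W.geomTwoTorsion_ne_zero h
  have h20 := W.geomTwoTorsion_ne_zero h.swap₁₂
  have h30 := W.geomTwoTorsion_ne_zero h.swap₂₃.swap₁₂
  have h21 : W.geomTwoTorsion h.swap₁₂ ≠ W.geomTwoTorsion h :=
    fun heq => h.ne₁₂ ((W.geomTwoTorsion_eq_iff h.swap₁₂ h).mp heq).symm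
  have h31 : W.geomTwoTorsion h.swap₂₃.swap₁₂ ≠ W.geomTwoTorsion h :=
    fun heq => h.ne₁₃ ((W.geomTwoTorsion_eq_iff h.swap₂₃.swap₁₂ h).mp heq).symm
  rcases hs with ⟨h1, h2, h3⟩ | ⟨h1, h2, h3⟩ | ⟨h1, h2, h3⟩ | ⟨h1, h2, h3⟩ <;>
    replace h1 : σ • u₁ = _ := h1 <;> replace h2 : σ • u₂ = _ := h2 <;>
    replace h3 : σ • u₃ = _ := h3
  · -- `σQ = Q`
    have hQ : σ • W.geomHalving h hu₁ hu₂ hu₃ = W.geomHalving h hu₁ hu₂ hu₃ :=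
      W.smul_geomHalving h σ hu₁ hu₂ hu₃ hu₁ hu₂ hu₃ h1 h2 h3
    refine ⟨1, Or.inl rfl, ?_, by rw [one_mul]; exact h1, by rw [one_mul, smul_mul', h2, h3]⟩
    simp only [hQ, sub_self, true_or, if_true, Units.val_one]
  · -- `σQ = Q + T₁`
    have hQ : σ • W.geomHalving h hu₁ hu₂ hu₃ = W.geomHalving h hu₁ hu₂ hu₃ + W.geomTwoTorsion h := by
      rw [W.geomHalving_add_geomTwoTorsion₁ h hu₁ hu₂ hu₃]
      exact W.smul_geomHalving h σ hu₁ hu₂ hu₃ hu₁ _ _ h1 h2 h3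
    refine ⟨1, Or.inl rfl, ?_, by rw [one_mul]; exact h1,
      by rw [one_mul, smul_mul', h2, h3]; ring⟩
    simp only [hQ, add_sub_cancel_left, or_true, if_true, Units.val_one]
  · -- `σQ = Q + T₂`
    have hQ : σ • W.geomHalving h hu₁ hu₂ hu₃ =
        W.geomHalving h hu₁ hu₂ hu₃ + W.geomTwoTorsion h.swap₁₂ := by
      rw [W.geomHalving_add_geomTwoTorsion₂ h hu₁ hu₂ hu₃]
      exact W.smul_geomHalving h σ hu₁ hu₂ hu₃ _ hu₂ _ h1 h2 h3
    refine ⟨-1, Or.inr rfl, ?_, by rw [neg_one_mul]; exact h1,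
      by rw [smul_mul', h2, h3]; ring⟩
    simp only [hQ, add_sub_cancel_left, h20, h21, or_self, if_false, Units.val_neg, Units.val_one]
  · -- `σQ = Q + T₃`
    have hQ : σ • W.geomHalving h hu₁ hu₂ hu₃ =
        W.geomHalving h hu₁ hu₂ hu₃ + W.geomTwoTorsion h.swap₂₃.swap₁₂ := by
      rw [W.geomHalving_add_geomTwoTorsion₃ h hu₁ hu₂ hu₃]
      exact W.smul_geomHalving h σ hu₁ hu₂ hu₃ _ _ hu₃ h1 h2 h3
    refine ⟨-1, Or.inr rfl, ?_, by rw [neg_one_mul]; exact h1,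
      by rw [smul_mul', h2, h3]; ring⟩
    simp only [hQ, add_sub_cancel_left, h30, h31, or_self, if_false, Units.val_neg, Units.val_one]


end WeierstrassCurve

end
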